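import Summits.QuantumFields.YangMills.Theorems.VirialFluxGapCentralFieldDefs
import Summits.QuantumFields.YangMills.Theorems.VirialFluxGapCentralProjection
import HarnessLib

/-!
# Route `VirialFluxGap` (YangMills): the explicit central field — basic identities: the clamped lift is the lift on the central region, the field at ring
# histories is `X_z + U` anchored at `π_C`, admissibility, and THE DRIVE IS ONE DIRECTIONAL DERIVATIVE (central chart C1 of ⟨stmt-QuantumFields-24141⟩)

Width seat `ym-line-sfw-p2-w3` g59 (cell ym-idea-1, free hands), `--supports stmt-QuantumFields-24141`.  Companion of the definitions file
✓`VirialFluxGapCentralFieldDefs` (`readQuat`, `imVec`, `blockAvgM`, `seamAvgM`, `clampRe`, `clampLift`, `anchoredIm`, `centralDir`, `centralCoeff`).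

* §1 `clamp_radicand_pos` (the radicand `1 − s·ψ(s)` is `> 0` for every real `s`), ★ `clampRe_eq_of_le_half` ∕ `clampLift_eq_liftQuat` (`|z|² ≤ ½ ⇒` the clamp
  is the central lift ✓`liftQuat`), `readQuat_coe` (`= su2Quat`), `readQuat_quatMatrix`, `blockAvgM_ringCoord` (`= blockIm (wrapBlock k) k`),
  `seamAvgM_ringCoord` (`= seamIm`);
* §2 ★★ the field AT A RING HISTORY on the central region (`|z_B|² ≤ ½`): `centralDir_wrap` ∕ `centralDir_seam` — the slot is
  `quatMatrix(0, Im(conj(q((π_C P)_w))·q(P_w)) + ½σ_B z_B)` = the memo's `U + X_z` anchored at ✓`centralProj`; `centralDir_other` (plain radial profile),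
  `centralDir_tree` (`0`);
* §3 admissibility: `centralDir_conjTranspose`, `centralDir_trace`, `centralDir_tree_zero`, hence ★ `dirOf_fixFrameStd_centralCoeff`
  (`dirOf fixFrameStd (centralCoeff σ σ₄ · M) = centralDir σ σ₄ M`, all `M`);
* §4 ★★★ `centralDrive_eq_frameD` — `Σ_va centralCoeff σ σ₄ va M · frameGrad fixFrameStd M va = frameD (centralDir σ σ₄ M) ringPoly M`: the (pos)∕(drive) clauses
  of w2's patching interface for the central piece are statements about ONE directional derivative of `ringPoly` in the direction `centralDir`.

HONEST LABEL: identities ∕ bookkeeping; smoothness of `centralCoeff`, the drive inequality (E1) and the divergence bound (E2) on the central region are NOT here;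
⟨24141⟩ and ⟨22884⟩ stay OPEN; the Yang–Mills mass gap is NOT proved by this; no summit is proved by a line.  THEOREMS ONLY (no `def`, no `sorry`).

References: [cite: CosteEtAl1985]; [cite: Luscher1983, §2]; [cite: arXiv220412737, §2 (2.4) (p. 10)].
-/

set_option autoImplicit false

noncomputable section

open scoped Matrix BigOperators Quaternion
open Literature.MathematicalPhysics.QuantumFieldTheory hiding SU2
open Literature.MathematicalPhysics.QuantumLattice

namespace Summit.QuantumFields.YangMills.Theorems.VirialFluxGap.CentralField

open Summit.QuantumFields.YangMills.Theorems.FemtoTransferGap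
open Summit.QuantumFields.YangMills.Theorems.FemtoTransferGap.TwoLattice.Flat (combFlat combFlat_apply)
open Summit.QuantumFields.YangMills.Theorems.VirialFluxGap.RingDeficit
open Summit.QuantumFields.YangMills.Theorems.VirialFluxGap.FrameDerivative
open Summit.QuantumFields.YangMills.Theorems.VirialFluxGap.FrameHessian
open Summit.QuantumFields.YangMills.Theorems.VirialFluxGap.FixFrame

variable {L : ℕ} [NeZero L]

/-! ## §1 The clamp, the read-off, the averages -/

section Clamp

omit [NeZero L]

/-- The clamp radicand is positive: `0 < 1 − s·ψ(s)` for every real `s` (`ψ` = ✓`deficitStep`: `ψ ≤ 1`, `ψ ≥ 0`, `ψ = 0` on `[1,∞)`). [folklore] -/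
theorem clamp_radicand_pos (s : ℝ) : 0 < 1 - s * deficitStep s := by
  by_cases hs : 1 ≤ s
  · rw [deficitStep_eq_zero hs, mul_zero, sub_zero]; exact one_pos
  · have hs' : s < 1 := lt_of_not_ge hs
    by_cases h0 : 0 ≤ s
    · have h1 : s * deficitStep s ≤ s * 1 := mul_le_mul_of_nonneg_left (deficitStep_le_one s) h0
      linarith
    · have h0' : s < 0 := lt_of_not_ge h0
      have h1 : s * deficitStep s ≤ 0 := mul_nonpos_of_nonpos_of_nonneg h0'.le (deficitStep_nonneg s)
      linarith

/-- ★ On `|z|² ≤ ½` the clamped real part is the real part of the central lift. [folklore] -/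
theorem clampRe_eq_of_le_half (σ : ℝ) {z : Fin 3 → ℝ} (hz : (z 0) ^ 2 + (z 1) ^ 2 + (z 2) ^ 2 ≤ 1 / 2) :
    clampRe σ z = σ * Real.sqrt (1 - ((z 0) ^ 2 + (z 1) ^ 2 + (z 2) ^ 2)) := by
  rw [clampRe, deficitStep_eq_one hz, mul_one]

/-- ★ On `|z|² ≤ ½` the clamped lift IS the central lift ✓`liftQuat`. [cite: CosteEtAl1985] -/
theorem clampLift_eq_liftQuat (σ : ℝ) {z : Fin 3 → ℝ} (hz : (z 0) ^ 2 + (z 1) ^ 2 + (z 2) ^ 2 ≤ 1 / 2) : clampLift σ z = liftQuat σ z := by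
  rw [clampLift, clampRe_eq_of_le_half σ hz]; rfl

/-- The read-off of an `SU(2)` matrix is its unit quaternion. [folklore] -/
theorem readQuat_coe (U : SU2) : readQuat (U : Matrix (Fin 2) (Fin 2) ℂ) = su2Quat U := rfl

/-- The read-off of `quatMatrix r` is `r`. [folklore] -/
theorem readQuat_quatMatrix (r : ℍ) : readQuat (quatMatrix r) = r := by
  unfold readQuat; ext <;> simp

/-- `imVec` in components. [folklore] -/
theorem imVec_apply (q : ℍ) : imVec q 0 = q.imI ∧ imVec q 1 = q.imJ ∧ imVec q 2 = q.imK := ⟨rfl, rfl, rfl⟩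

end Clamp

/-- The block average read off the coordinates of a ring history is the block average ✓`blockIm`. [folklore] -/
theorem blockAvgM_ringCoord (k : Fin 3) (P : (Fin (2 * L - 1 + 1) → GaugeConfig 3 L SU2) × (Site 3 L → SU2)) :
    blockAvgM L k (ringCoord L P) = blockIm L (wrapBlock L k) k P := by
  funext a
  fin_cases a <;> rfl

/-- The seam average read off the coordinates of a ring history is ✓`seamIm`. [folklore] -/
theorem seamAvgM_ringCoord (P : (Fin (2 * L - 1 + 1) → GaugeConfig 3 L SU2) × (Site 3 L → SU2)) :
    seamAvgM L (ringCoord L P) = seamIm L P := by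
  funext a
  fin_cases a <;> rfl

/-! ## §2 The field at a ring history on the central region -/

/-- The anchored profile of a ring-history slot in quaternion letters. [folklore] -/
theorem anchoredIm_ringCoord_slice (c : ℍ) (P : (Fin (2 * L - 1 + 1) → GaugeConfig 3 L SU2) × (Site 3 L → SU2)) (i : Fin (2 * L - 1 + 1)) (e : Edge 3 L) :
    anchoredIm c ((ringCoord L P).1 i e) = imVec (star c * su2Quat (P.1 i e)) := rfl

/-- The same for a seam slot. [folklore] -/
theorem anchoredIm_ringCoord_seam (c : ℍ) (P : (Fin (2 * L - 1 + 1) → GaugeConfig 3 L SU2) × (Site 3 L → SU2)) (x : Site 3 L) :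
    anchoredIm c ((ringCoord L P).2 x) = imVec (star c * su2Quat (P.2 x)) := rfl

/-- ★★ **The central field at a wrap-block variable of a ring history on the central region** (`|z_k|² ≤ ½`): the slot direction is
`quatMatrix(0, Im(conj(q((π_C P)_{i,(x,k)}))·q(P_{i,(x,k)})) + ½σ_k z_k)` — the anchored radial profile at the central projection plus the block zero-mode field.
[cite: CosteEtAl1985] -/
theorem centralDir_wrap {σ : Fin 3 → ℝ} (hσ : ∀ k, σ k = 1 ∨ σ k = -1) (σ₄ : ℝ) (P : (Fin (2 * L - 1 + 1) → GaugeConfig 3 L SU2) × (Site 3 L → SU2))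
    (i : Fin (2 * L - 1 + 1)) {x : Site 3 L} {k : Fin 3} (hx : x k = -1)
    (hz : (blockIm L (wrapBlock L k) k P 0) ^ 2 + (blockIm L (wrapBlock L k) k P 1) ^ 2 + (blockIm L (wrapBlock L k) k P 2) ^ 2 ≤ 1 / 2) :
    centralDir L σ σ₄ (ringCoord L P) (Sum.inl (i, (x, k))) =
      quatMatrix ⟨0,
        (star (su2Quat ((centralProj L σ σ₄ P).1 i (x, k))) * su2Quat (P.1 i (x, k))).imI + (1 / 2 : ℝ) * σ k * blockIm L (wrapBlock L k) k P 0,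
        (star (su2Quat ((centralProj L σ σ₄ P).1 i (x, k))) * su2Quat (P.1 i (x, k))).imJ + (1 / 2 : ℝ) * σ k * blockIm L (wrapBlock L k) k P 1,
        (star (su2Quat ((centralProj L σ σ₄ P).1 i (x, k))) * su2Quat (P.1 i (x, k))).imK + (1 / 2 : ℝ) * σ k * blockIm L (wrapBlock L k) k P 2⟩ := by
  have htree : ¬(i = 0 ∧ treeEdge ((x, k) : Edge 3 L) = true) := fun h => not_treeEdge_of_wrap (e := (x, k)) hx h.2
  have hπ : su2Quat ((centralProj L σ σ₄ P).1 i (x, k)) = liftQuat (σ k) (blockIm L (wrapBlock L k) k P) := by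
    show su2Quat (combFlat (fun k => centralRep (σ k) (blockIm L (wrapBlock L k) k P)) (x, k)) = _
    rw [combFlat_apply, if_pos hx, su2Quat_centralRep (sq_eq_one_of_sign (hσ k)) (normSq_blockIm_le_one _ k P)]
  rw [centralDir, if_neg htree, if_pos hx, blockAvgM_ringCoord, clampLift_eq_liftQuat _ hz, hπ]
  rfl

/-- ★★ **The central field at a seam variable of a ring history on the central region** (`|z₄|² ≤ ½`). [cite: CosteEtAl1985] -/
theorem centralDir_seam (σ : Fin 3 → ℝ) {σ₄ : ℝ} (hσ₄ : σ₄ = 1 ∨ σ₄ = -1) (P : (Fin (2 * L - 1 + 1) → GaugeConfig 3 L SU2) × (Site 3 L → SU2))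
    (x : Site 3 L) (hz : (seamIm L P 0) ^ 2 + (seamIm L P 1) ^ 2 + (seamIm L P 2) ^ 2 ≤ 1 / 2) :
    centralDir L σ σ₄ (ringCoord L P) (Sum.inr x) =
      quatMatrix ⟨0,
        (star (su2Quat ((centralProj L σ σ₄ P).2 x)) * su2Quat (P.2 x)).imI + (1 / 2 : ℝ) * σ₄ * seamIm L P 0,
        (star (su2Quat ((centralProj L σ σ₄ P).2 x)) * su2Quat (P.2 x)).imJ + (1 / 2 : ℝ) * σ₄ * seamIm L P 1,
        (star (su2Quat ((centralProj L σ σ₄ P).2 x)) * su2Quat (P.2 x)).imK + (1 / 2 : ℝ) * σ₄ * seamIm L P 2⟩ := by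
  have hπ : su2Quat ((centralProj L σ σ₄ P).2 x) = liftQuat σ₄ (seamIm L P) := by
    show su2Quat (centralRep σ₄ (seamIm L P)) = _
    rw [su2Quat_centralRep (sq_eq_one_of_sign hσ₄) (normSq_seamIm_le_one P)]
  rw [centralDir, seamAvgM_ringCoord, clampLift_eq_liftQuat _ hz, hπ]
  rfl

/-- The central field at a non-block, non-tree variable of a ring history: the plain radial profile `quatMatrix(0, Im q(P_{i,e}))`. [cite: arXiv220412737, §2 (2.4) (p. 10)] -/
theorem centralDir_other (σ : Fin 3 → ℝ) (σ₄ : ℝ) (P : (Fin (2 * L - 1 + 1) → GaugeConfig 3 L SU2) × (Site 3 L → SU2))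
    (i : Fin (2 * L - 1 + 1)) (e : Edge 3 L) (htree : ¬(i = 0 ∧ treeEdge e = true)) (hx : e.1 e.2 ≠ -1) :
    centralDir L σ σ₄ (ringCoord L P) (Sum.inl (i, e)) =
      quatMatrix ⟨0, (su2Quat (P.1 i e)).imI, (su2Quat (P.1 i e)).imJ, (su2Quat (P.1 i e)).imK⟩ := by
  rw [centralDir, if_neg htree, if_neg hx]
  simp only [anchoredIm, star_one, one_mul]
  rfl

/-- The central field vanishes on the slice-`0` comb tree (all coordinates). [folklore] -/
theorem centralDir_tree (σ : Fin 3 → ℝ) (σ₄ : ℝ)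
    (M : (Fin (2 * L - 1 + 1) → Edge 3 L → Matrix (Fin 2) (Fin 2) ℂ) × (Site 3 L → Matrix (Fin 2) (Fin 2) ℂ)) {e : Edge 3 L} (he : treeEdge e = true) :
    centralDir L σ σ₄ M (Sum.inl (0, e)) = 0 := by
  rw [centralDir, if_pos ⟨rfl, he⟩]

/-! ## §3 Admissibility: skew-Hermitian, traceless, tree-vanishing -/

/-- The central direction assignment is skew-Hermitian at every variable (all coordinates). [folklore] -/
theorem centralDir_conjTranspose (σ : Fin 3 → ℝ) (σ₄ : ℝ)
    (M : (Fin (2 * L - 1 + 1) → Edge 3 L → Matrix (Fin 2) (Fin 2) ℂ) × (Site 3 L → Matrix (Fin 2) (Fin 2) ℂ))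
    (w : (Fin (2 * L - 1 + 1) × Edge 3 L) ⊕ Site 3 L) : (centralDir L σ σ₄ M w)ᴴ = -centralDir L σ σ₄ M w := by
  rcases w with ⟨i, e⟩ | x
  · simp only [centralDir]
    split_ifs
    · simp
    · exact quatMatrix_im_conjTranspose _ _ _
    · exact quatMatrix_im_conjTranspose _ _ _
  · simp only [centralDir]
    exact quatMatrix_im_conjTranspose _ _ _

/-- The central direction assignment is traceless at every variable (all coordinates). [folklore] -/
theorem centralDir_trace (σ : Fin 3 → ℝ) (σ₄ : ℝ)
    (M : (Fin (2 * L - 1 + 1) → Edge 3 L → Matrix (Fin 2) (Fin 2) ℂ) × (Site 3 L → Matrix (Fin 2) (Fin 2) ℂ))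
    (w : (Fin (2 * L - 1 + 1) × Edge 3 L) ⊕ Site 3 L) : (centralDir L σ σ₄ M w).trace = 0 := by
  rcases w with ⟨i, e⟩ | x
  · simp only [centralDir]
    split_ifs
    · simp
    · exact quatMatrix_im_trace _ _ _
    · exact quatMatrix_im_trace _ _ _
  · simp only [centralDir]
    exact quatMatrix_im_trace _ _ _

/-- ★ **The coefficient family recovers the direction assignment**: `dirOf fixFrameStd (centralCoeff σ σ₄ · M) = centralDir σ σ₄ M` (all coordinates `M`).
[folklore] -/
theorem dirOf_fixFrameStd_centralCoeff (σ : Fin 3 → ℝ) (σ₄ : ℝ)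
    (M : (Fin (2 * L - 1 + 1) → Edge 3 L → Matrix (Fin 2) (Fin 2) ℂ) × (Site 3 L → Matrix (Fin 2) (Fin 2) ℂ)) :
    dirOf (fixFrameStd (L := L)) (fun va => centralCoeff L σ σ₄ va M) = centralDir L σ σ₄ M :=
  dirOf_fixFrameStd_fixCoord (centralDir_conjTranspose σ σ₄ M) (centralDir_trace σ σ₄ M) (fun _ he => centralDir_tree σ σ₄ M he)

/-! ## §4 The drive is one directional derivative -/

/-- ★★★ **The drive of the central piece is ONE directional derivative**: `Σ_va c²_va(M)·frameGrad fixFrameStd M va = frameD (centralDir σ σ₄ M) ringPoly M`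
(all coordinates `M`).  The (pos) and (drive) clauses of ✓`FieldPatching` for the central piece are thus statements about the derivative of `ringPoly` along the
explicit assignment `centralDir`. [cite: CosteEtAl1985] -/
theorem centralDrive_eq_frameD (σ : Fin 3 → ℝ) (σ₄ : ℝ)
    (M : (Fin (2 * L - 1 + 1) → Edge 3 L → Matrix (Fin 2) (Fin 2) ℂ) × (Site 3 L → Matrix (Fin 2) (Fin 2) ℂ)) :
    ∑ va : FixVar L × Fin 3, centralCoeff L σ σ₄ va M * frameGrad (fixFrameStd (L := L)) M va = frameD (centralDir L σ σ₄ M) (ringPoly L) M := by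
  rw [← dirOf_fixFrameStd_centralCoeff σ σ₄ M, frameD_dirOf]
  rfl

end Summit.QuantumFields.YangMills.Theorems.VirialFluxGap.CentralField

end
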